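import Summits.FinalStateConjecture.FinalStateConjecture.Theses.ExactKerrEnds
import Summits.FinalStateConjecture.FinalStateConjecture.Theorems.ExactKerrEndsCensorshipAlongKerrEndsNonposMassCensored
import HarnessLib

/-!
# Route ExactKerrEnds — crux `ZeroMassAdmissibleMinkowskian` (stmt-FinalStateConjecture-18053):
# conditional closure from the named fact `positive_mass_rigidity_spacetime`

The crux (#7 of the route, binder `hZ` of the deciding theorem `closes` since rev 5) is the RIGID
POSITIVE ENERGY THEOREM ON THE ADMISSIBLE VACUUM CLASS: an admissible vacuum datum `d` on `X` which is
DR-flat with mass parameter `0` on a sole end `e` (`h = δ + o₂(r⁻¹)`, `k = o₁(r⁻²)`) has a Cauchy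
development WHICH IS Minkowski space-time,
`∃ 𝒟 : CauchyDevelopment d, 𝒟.toSpacetime = Minkowski.spacetime`.

It is the vacuum, `E_ADM = 0` special case of Beig–Chruściel 1996, Thm. 4.1, which the tree holds as
the undischarged NAMED FACT `Literature.Geometry.Lorentzian.positive_mass_rigidity_spacetime`
(`SpacetimePositiveMassRigidity.lean`). This file records the conditional closure of the item from that
fact ALONE — no positive mass theorem is needed at `M = 0` — in the pattern of
`mghdExistence_of_choquetBruhatGeroch` for the shared crux `MGHDExists`: admissible data satisfy the
dominant energy condition (`satisfiesDominantEnergyCondition_of_mem_admissibleVacuumData`) with sources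
decaying at every rate (`hasSourceDecay_of_mem_admissibleVacuumData`), are asymptotically flat of order
`1` on a DR-flat end (`IsStronglyAsymptoticallyFlatDR.IsAsymptoticallyFlat_one_holds`), and the ADM
energy flux of a DR-flat end with parameter `0` converges to `0` (`IsStronglyAsymptoticallyFlatDR.hasADMEnergy`);
these are verbatim the hypotheses of the fact. The item itself stays open until the fact is discharged.
Downstream (landed, unconditional): such a datum is censored
(`CensorshipAlongKerrEnds.censored_of_cauchyDevelopment_eq_minkowski`) and Kerr-ended with `M = 0`
(`hasExactKerrEnd_of_cauchyDevelopment_eq_minkowski`).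

References: Beig–Chruściel, J. Math. Phys. 37 (1996), Thm. 4.1 (case `m = 0`); Witten, CMP 80 (1981);
Dafermos–Rodnianski, Clay lecture notes (2013) / arXiv:0811.0354, App. B.2.3 (the DR decay class).
-/

-- the doubled `FinalStateConjecture.FinalStateConjecture` path component trips dupNamespace
set_option linter.dupNamespace false

noncomputable section

open scoped Manifold ContDiff Topology

namespace Summit.FinalStateConjecture.FinalStateConjecture.Theorems.ExactKerrEnds

open Literature.Geometry.Lorentzian
open Summit.FinalStateConjecture.FinalStateConjecture.Theses.ExactKerrEnds (ZeroMassAdmissibleMinkowskian)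

/-- **An admissible datum which is DR-flat with mass parameter `0` on a sole end has a Cauchy
development which is Minkowski space-time, granted the rigid positive energy theorem**
(`positive_mass_rigidity_spacetime`, Beig–Chruściel 1996, Thm. 4.1, `m = 0`): the fact applied with the
dominant energy condition, source decay, order-`1` asymptotic flatness and `E_ADM = 0` of such data.
[cite: BeigChrusciel1996, Thm. 4.1 (§4), case m = 0] [cite: DafermosRodnianski2013, App. B.2.3] -/
theorem exists_cauchyDevelopment_eq_minkowski_of_rigidity (hrig : positive_mass_rigidity_spacetime)
    {X : Type} [TopologicalSpace X] [ChartedSpace E3 X] [IsManifold (𝓡 3) ∞ X] [T2Space X]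
    [SecondCountableTopology X] [ConnectedSpace X] {d : InitialDataSet (𝓡 3) X}
    (hd : d ∈ admissibleVacuumData X) {e : AFEnd X} (hsole : e.IsSoleEnd)
    (hDR : e.IsStronglyAsymptoticallyFlatDR d 0) :
    ∃ 𝒟 : CauchyDevelopment d, 𝒟.toSpacetime = Minkowski.spacetime := by
  haveI := d.metric.hasLeviCivita
  exact hrig X d e (satisfiesDominantEnergyCondition_of_mem_admissibleVacuumData hd)
    (AFEnd.IsStronglyAsymptoticallyFlatDR.IsAsymptoticallyFlat_one_holds e d hDR)
    ⟨1, hasSourceDecay_of_mem_admissibleVacuumData e hd one_pos⟩ hsole hDR.hasADMEnergy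

/-- **The crux `ZeroMassAdmissibleMinkowskian` follows from the rigid positive energy theorem**
(conditional closure of item stmt-FinalStateConjecture-18053 from the named fact
`positive_mass_rigidity_spacetime` ALONE, Beig–Chruściel 1996, Thm. 4.1, `m = 0`).
[cite: BeigChrusciel1996, Thm. 4.1 (§4), case m = 0] -/
theorem zeroMassAdmissibleMinkowskian_of_rigidity (hrig : positive_mass_rigidity_spacetime) :
    ZeroMassAdmissibleMinkowskian := by
  intro X _ _ _ _ _ _ d hd e hsole hDR
  exact exists_cauchyDevelopment_eq_minkowski_of_rigidity hrig hd hsole hDR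

end Summit.FinalStateConjecture.FinalStateConjecture.Theorems.ExactKerrEnds

end
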